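import Literature.Computability.Complexity.SuccinctKernelVectorValues
import Literature.Computability.AlgebraicComplexity.KV20SuccinctMatrixData
import Literature.Computability.Complexity.SuccinctCircuitBitsEvaluator
import HarnessLib

/-!
# The output gates of the Kumar–Volk kernel-vector circuit (KV20 M1 programme, step (P6)/D, part 1)

The succinct kernel-vector circuit `KVC.kvc Φ` (files `SuccinctKernelVectorGates/Circuit/Values`)
run on t21 g12's polynomial-time matrix family `KumarVolk2020.kvMatrixFamily` (the canonical
Kumar–Volk system `evalMat (uFinFlat n) (n^3) (kvGridBound n)`) has, for every `n ≥ 1` and every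
column `c < (n^3+1)^{n^2}`, two designated output gates `outName Φ n 0 c`, `outName Φ n 1 c` whose
values `V⁺, V⁻ < 2^{Wmux n}` satisfy `V⁺ − V⁻ = kvKernelEntry n c` — the `c`-th coefficient of the
canonical equation `Q_n` of [KV22, §6 (proof of Cor. 1.3)] in t21 g11's normal form. Together with
the `FP` codes of the output names (curried forms of `KVC.codeFP_outName`) and of the select width
`Wmux` these are exactly the hypotheses `hvp, hvn, hv, hlt, hsub` of the split-gate closer; the bit
language of the circuit is in `PSPACE` by p1 g9's `SuccCircuit.bitLang_mem_PSPACE`.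

Theorems only; no facts (D-0026); census +0 (the closer `kumarVolk2020_cor_1_3_holds` follows in
`KV20Cor13Holds.lean`).

## References
* [KV22] M. Kumar, B. L. Volk, *A polynomial degree bound on equations for non-rigid matrices and
  small linear circuits*, ACM ToCT 14(2) (2022), §6, Cor. 1.3. [cite: KumarVolk2022, §6]
* [KP09] P. Koiran, S. Perifel, *VPSPACE and a transfer theorem over the reals*, Comput. Complexity
  18 (2009), §3.2 Prop. 1. [cite: KoiranPerifel2009VPSPACE, §3.2]
* [BvzGH82] A. Borodin, J. von zur Gathen, J. Hopcroft, *Fast parallel matrix and GCD computations*,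
  Inf. Control 52 (1982), §5. [cite: BorodinVonzurgathenHopcroft1982, §5]
* [AB09] S. Arora, B. Barak, *Computational Complexity*, CUP 2009, §1.3, §6.8. [cite: AroraBarak2009, §6.8]
-/

noncomputable section

/-! ### Read-out plumbing for the output gates (generic in the family `Φ`) -/

namespace Literature.Computability.Complexity.KVC

open _root_.Computability CodeFP Brick Finset CodeFP.AExp SuccCircuit
open Literature.LinearAlgebra Literature.Computability.AlgebraicComplexity

variable (Φ : SuccIntMatrixFamily)

/-- **The select width `Wmux` is polynomial-time in binary** (item 7 of `params`). [cite: AroraBarak2009, §1.3] -/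
theorem Wmux_fp : CodeFP unE natE Φ.Wmux :=
  ((rawHeadD natE (d := 0) rfl).comp ((rawTail natE).comp ((rawTail natE).comp ((rawTail natE).comp
    ((rawTail natE).comp ((rawTail natE).comp ((rawTail natE).comp ((rawTail natE).comp Φ.params_fp)))))))).congr
    fun n => by simp [SuccIntMatrixFamily.params]

/-- The output tuples are well formed. [cite: KoiranPerifel2009VPSPACE, §3.2] -/
theorem wf_outName {n s c : ℕ} (hs : s ≤ 1) (hc : c < Φ.N n) : WF Φ n (Φ.Lreq n) [29, s, c, 0, 0, 0, 0, 0] := by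
  obtain ⟨hFB, h2X, h2R, h2NN, h2N1, -⟩ := Φ.param_facts n
  refine (wf_V Φ).2 ⟨?_, hc⟩
  simp only [GWF]
  exact ⟨by norm_num, hs, by omega, by omega, by omega, by omega, by omega, by omega, le_rfl, by omega⟩

/-- ★ **The output gates are below the select width**: `val V(s,c) < 2^{Wmux n}`. [cite: KoiranPerifel2009VPSPACE, §3.2, Prop. 1] -/
theorem outName_val_lt {n s c : ℕ} (hs : s ≤ 1) (hc : c < Φ.N n) : (kvc Φ).val (outName Φ n s c) < 2 ^ Φ.Wmux n :=
  val_lt_Wmux Φ (isCan_G Φ (wf_outName Φ hs hc))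

/-- The positive output names `V(0, c)` are polynomial-time in `(1ⁿ, c)`. [cite: KoiranPerifel2009VPSPACE, §3.2] -/
theorem codeFP_outName₀ : CodeFP (pairE unE natE) strE (fun p => outName Φ p.1 0 p.2) :=
  ((codeFP_outName Φ).comp ((CodeFP.fst _ _).pair ((const _ 0).pair (CodeFP.snd _ _)))).congr fun _ => rfl

/-- The negative output names `V(1, c)` are polynomial-time in `(1ⁿ, c)`. [cite: KoiranPerifel2009VPSPACE, §3.2] -/
theorem codeFP_outName₁ : CodeFP (pairE unE natE) strE (fun p => outName Φ p.1 1 p.2) :=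
  ((codeFP_outName Φ).comp ((CodeFP.fst _ _).pair ((const _ 1).pair (CodeFP.snd _ _)))).congr fun _ => rfl

end Literature.Computability.Complexity.KVC

/-! ### The Kumar–Volk instance: the output gates of `kvc kvMatrixFamily` carry the kernel entries -/

namespace Literature.Computability.AlgebraicComplexity.KumarVolk2020

open Literature.LinearAlgebra Literature.Computability.Complexity Literature.Computability.Complexity.KVC
open _root_.Computability Literature.Computability.Complexity.CodeFP Brick

/-- ★ **The output gate pair of the Kumar–Volk circuit is worth the kernel vector of `(kvAmat n)ᵀ kvAmat n`.**
[cite: KumarVolk2022, §6 (proof of Cor. 1.3)] [cite: BorodinVonzurgathenHopcroft1982, §5 (NULLSPACE)] -/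
theorem kvc_val_sub {n : ℕ} (hn : 1 ≤ n) (c : Fin (kvCols n)) :
    (((kvc kvMatrixFamily).val (outName kvMatrixFamily n 0 c) : ℤ) - (kvc kvMatrixFamily).val (outName kvMatrixFamily n 1 c)) =
      charpolyKernelVector ((kvAmat n).transpose * kvAmat n) c :=
  outName_val_sub kvMatrixFamily (two_le_kvCols hn) c

/-- ★ **… hence worth `kvKernelEntry n c`** (the closer's hypothesis `hsub`). [cite: KumarVolk2022, §6 (proof of Cor. 1.3)] -/
theorem kvc_val_sub_kernelEntry :
    ∀ n c : ℕ, 1 ≤ n → c < (n ^ 3 + 1) ^ (n * n) →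
      (((kvc kvMatrixFamily).val (outName kvMatrixFamily n 0 c) : ℤ) - (kvc kvMatrixFamily).val (outName kvMatrixFamily n 1 c)) =
        UEval.kvKernelEntry n c :=
  kernelEntry_of_gateValues (Ap := fun n c => (kvc kvMatrixFamily).val (outName kvMatrixFamily n 0 c))
    (Am := fun n c => (kvc kvMatrixFamily).val (outName kvMatrixFamily n 1 c)) fun _ hn c => kvc_val_sub hn c

/-- **The output gates are below `2^{Wmux n}`** (the closer's hypothesis `hlt`). [cite: KoiranPerifel2009VPSPACE, §3.2, Prop. 1] -/
theorem kvc_val_lt :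
    ∀ n c : ℕ, 1 ≤ n → c < (n ^ 3 + 1) ^ (n * n) →
      (kvc kvMatrixFamily).val (outName kvMatrixFamily n 0 c) < 2 ^ kvMatrixFamily.Wmux n ∧
        (kvc kvMatrixFamily).val (outName kvMatrixFamily n 1 c) < 2 ^ kvMatrixFamily.Wmux n :=
  fun _ _ _ hc => ⟨outName_val_lt kvMatrixFamily (by norm_num) hc, outName_val_lt kvMatrixFamily (by norm_num) hc⟩

/-- `|kvKernelEntry n c| < 2^{Wmux n}` (the closer's hypothesis `hb`). [cite: KoiranPerifel2009VPSPACE, §3.2, Prop. 1] -/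
theorem natAbs_kvKernelEntry_lt {n c : ℕ} (hn : 1 ≤ n) (hc : c < (n ^ 3 + 1) ^ (n * n)) :
    (UEval.kvKernelEntry n c).natAbs < 2 ^ kvMatrixFamily.Wmux n := by
  rw [← kvc_val_sub_kernelEntry n c hn hc]
  have h := kvc_val_lt n c hn hc
  omega

/-- **The bit language of the Kumar–Volk circuit is in `PSPACE`** (p1 g9's evaluator). [cite: KoiranPerifel2009VPSPACE, §3.2, Prop. 1] -/
theorem kvc_bitLang_mem_PSPACE : (kvc kvMatrixFamily).bitLang ∈ PSPACE := (kvc kvMatrixFamily).bitLang_mem_PSPACE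

end Literature.Computability.AlgebraicComplexity.KumarVolk2020

end
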